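import Summits.KontsevichZagierPeriods.KontsevichZagierPeriods.Theorems.GammaHodgeSector.Negative.Fermat33
import Literature.NumberTheory.Transcendental.BetaSymbolGroup

/-!
# `GammaHodgeSector` (stmt-KontsevichZagierPeriods-3742), instance line `InstanceSixtySix`:
stub `stub_koCertificates66` — the two exact Koblitz–Ogus certificates at level 66

For the level-33 quadratic pair `DasDeepThirtyThree` (`B(1/33,1/33)B(2/33,22/33) ∝ B(1/33,3/33)B(2/33,14/33)`)
and for the `(5, 0, 3)` datum `x33, y33` of `Negative/Fermat33` (da Silva's class on `X⁴₃₃`), the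
class vector at level `66` of the symbol, corrected by the ONE level-66 linear pair
`[1/22,1/3] − [1/22,16/33]` (class `e₂₂ − e₂₅ − e₃₂ + e₃₅`), is an explicit ℤ-combination of
Koblitz–Ogus generators (`reflVec`, `distVec` of `BetaSymbolGroup`):

* `clD₆₆(Das33) + clD₆₆(pair) = dist(33,2) − refl 18 − dist(22,6) − dist(33,25) + refl 8 + refl 22`
  (two duplications, one triplication, three reflections);
* `clD₆₆(Fermat33 − 3[½,½]) − clD₆₆(pair) = −dist(33,2) + dist(33,25) − 3·refl 33 − refl 8 − refl 4 + dist(6,2) + refl 0`.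

Found by exact integer elimination over the 110 generators of `koSpan 66` (rank 56); neither class
vector lies in `koSpan 66` itself (only its double does). Reference: Deligne LNM 900 §7, Rem. 7.16 (a)
(Koblitz–Ogus); N. Aoki, Amer. J. Math. 113 (1991) (exceptional isogenies of Fermat factors).
-/

noncomputable section

open scoped BigOperators

namespace Summit.KontsevichZagierPeriods.GammaHodgeSectorRaise66

open Literature.NumberTheory.Transcendental Literature.NumberTheory.Transcendental.BetaSymbol
open Summit.KontsevichZagierPeriods.GammaHodgeSectorNegative (x33 y33)

/-- Reflection vectors lie in the Koblitz–Ogus span. [folklore] -/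
theorem reflVec_mem_koSpan (D : ℕ) (a : ZMod D) : reflVec D a ∈ koSpan D :=
  AddSubgroup.subset_closure (Or.inl ⟨a, rfl⟩)

/-- Distribution vectors (`M ∣ D`) lie in the Koblitz–Ogus span. [folklore] -/
theorem distVec_mem_koSpan {D M : ℕ} (hM : M ∈ D.divisors) (y : ZMod D) : distVec D M y ∈ koSpan D :=
  AddSubgroup.subset_closure (Or.inr ⟨M, hM, y, rfl⟩)

/-- **Certificate for `DasDeepThirtyThree` at level 66** (class-vector identity). [folklore] -/
theorem clD_das33_add_pair :
    clD 66 (wordSym (![1/33, 2/33] : Fin 2 → ℚ) (![1/33, 22/33] : Fin 2 → ℚ)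
        - wordSym (![1/33, 2/33] : Fin 2 → ℚ) (![3/33, 14/33] : Fin 2 → ℚ)
        + (bsym (1/22) (1/3) - bsym (1/22) (16/33))) =
      distVec 66 33 2 - reflVec 66 18 - distVec 66 22 6 - distVec 66 33 25 + reflVec 66 8 + reflVec 66 22 := by
  simp only [wordSym, Fin.sum_univ_two, Matrix.cons_val_zero, Matrix.cons_val_one, map_add, map_sub,
    clD_bsym]
  funext x
  simp only [Pi.add_apply, Pi.sub_apply, eZ, reflVec, distVec, toZMod]
  revert x
  decide +kernel

/-- **Certificate for the Fermat-33 datum at level 66** (class-vector identity). [folklore] -/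
theorem clD_fermat33_sub_pair :
    clD 66 (wordSym x33 y33 - wordSym (Fin.elim0 : Fin 0 → ℚ) (Fin.elim0 : Fin 0 → ℚ)
        - (3:ℕ) • bsym (1 / 2) (1 / 2) - (bsym (1/22) (1/3) - bsym (1/22) (16/33))) =
      -distVec 66 33 2 + distVec 66 33 25 - (3:ℤ) • reflVec 66 33 - reflVec 66 8 - reflVec 66 4
        + distVec 66 6 2 + reflVec 66 0 := by
  simp only [wordSym, x33, y33, Fin.sum_univ_five, Finset.univ_eq_empty, Finset.sum_empty, sub_zero,
    Matrix.cons_val_zero, Matrix.cons_val_one, Matrix.cons_val_two, Matrix.cons_val_three,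
    Matrix.cons_val_four, Matrix.head_cons, Matrix.tail_cons, map_add, map_sub, map_nsmul, clD_bsym]
  funext x
  simp only [Pi.add_apply, Pi.sub_apply, Pi.neg_apply, Pi.smul_apply, smul_eq_mul, eZ, reflVec, distVec,
    toZMod]
  revert x
  decide +kernel

/-- **STUB `stub_koCertificates66`** (registered signature): both corrected class vectors lie in
`koSpan 66`. [folklore] -/
theorem stub_koCertificates66 :
    clD 66 (wordSym (![1/33, 2/33] : Fin 2 → ℚ) (![1/33, 22/33] : Fin 2 → ℚ)
        - wordSym (![1/33, 2/33] : Fin 2 → ℚ) (![3/33, 14/33] : Fin 2 → ℚ)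
        + (bsym (1/22) (1/3) - bsym (1/22) (16/33))) ∈ koSpan 66 ∧
    clD 66 (wordSym x33 y33 - wordSym (Fin.elim0 : Fin 0 → ℚ) (Fin.elim0 : Fin 0 → ℚ)
        - (3:ℕ) • bsym (1 / 2) (1 / 2) - (bsym (1/22) (1/3) - bsym (1/22) (16/33))) ∈ koSpan 66 := by
  have h33 : (33:ℕ) ∈ Nat.divisors 66 := by decide
  have h22 : (22:ℕ) ∈ Nat.divisors 66 := by decide
  have h6 : (6:ℕ) ∈ Nat.divisors 66 := by decide
  refine ⟨?_, ?_⟩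
  · rw [clD_das33_add_pair]
    exact add_mem (add_mem (sub_mem (sub_mem (sub_mem (distVec_mem_koSpan h33 _) (reflVec_mem_koSpan _ _))
      (distVec_mem_koSpan h22 _)) (distVec_mem_koSpan h33 _)) (reflVec_mem_koSpan _ _)) (reflVec_mem_koSpan _ _)
  · rw [clD_fermat33_sub_pair]
    exact add_mem (add_mem (sub_mem (sub_mem (sub_mem (add_mem (neg_mem (distVec_mem_koSpan h33 _))
      (distVec_mem_koSpan h33 _)) (AddSubgroup.zsmul_mem _ (reflVec_mem_koSpan _ _) _))
      (reflVec_mem_koSpan _ _)) (reflVec_mem_koSpan _ _)) (distVec_mem_koSpan h6 _)) (reflVec_mem_koSpan _ _)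

/-- Level-`66` membership of the level-33 quadratic pair data. [folklore] -/
theorem isLevel66_das33 :
    ∀ j : Fin 2, (IsLevel 66 ((![1/33, 2/33] : Fin 2 → ℚ) j) ∧ IsLevel 66 ((![1/33, 22/33] : Fin 2 → ℚ) j)) ∧
      (IsLevel 66 ((![1/33, 2/33] : Fin 2 → ℚ) j) ∧ IsLevel 66 ((![3/33, 14/33] : Fin 2 → ℚ) j)) := by
  unfold IsLevel
  decide +kernel

/-- Level-`66` membership of the Fermat-33 datum. [folklore] -/
theorem isLevel66_fermat33 : ∀ j : Fin 5, IsLevel 66 (x33 j) ∧ IsLevel 66 (y33 j) := by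
  unfold IsLevel x33 y33
  decide +kernel

/-- Level-`66` membership of `1/22`, `1/3`, `16/33`, `1/2`. [folklore] -/
theorem isLevel66_pair : IsLevel 66 (1/22) ∧ IsLevel 66 (1/3) ∧ IsLevel 66 (16/33) ∧ IsLevel 66 (1 / 2) := by
  unfold IsLevel
  decide +kernel

/-- **STUB `stub_levelWeight66`** (registered signature): the two corrected symbols are of level `66`
and Hodge weight `0`. [folklore] -/
theorem stub_levelWeight66 :
    (wordSym (![1/33, 2/33] : Fin 2 → ℚ) (![1/33, 22/33] : Fin 2 → ℚ)
        - wordSym (![1/33, 2/33] : Fin 2 → ℚ) (![3/33, 14/33] : Fin 2 → ℚ)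
        + (bsym (1/22) (1/3) - bsym (1/22) (16/33)) ∈ levelSym 66 ∧
      weight (wordSym (![1/33, 2/33] : Fin 2 → ℚ) (![1/33, 22/33] : Fin 2 → ℚ)
        - wordSym (![1/33, 2/33] : Fin 2 → ℚ) (![3/33, 14/33] : Fin 2 → ℚ)
        + (bsym (1/22) (1/3) - bsym (1/22) (16/33))) = 0) ∧
    (wordSym x33 y33 - wordSym (Fin.elim0 : Fin 0 → ℚ) (Fin.elim0 : Fin 0 → ℚ)
        - (3:ℕ) • bsym (1 / 2) (1 / 2) - (bsym (1/22) (1/3) - bsym (1/22) (16/33)) ∈ levelSym 66 ∧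
      weight (wordSym x33 y33 - wordSym (Fin.elim0 : Fin 0 → ℚ) (Fin.elim0 : Fin 0 → ℚ)
        - (3:ℕ) • bsym (1 / 2) (1 / 2) - (bsym (1/22) (1/3) - bsym (1/22) (16/33))) = 0) := by
  obtain ⟨h22, h3, h16, hhalf⟩ := isLevel66_pair
  have hpair : bsym (1/22) (1/3) - bsym (1/22) (16/33) ∈ levelSym 66 :=
    sub_mem (bsym_mem_levelSym h22 h3) (bsym_mem_levelSym h22 h16)
  refine ⟨⟨?_, ?_⟩, ⟨?_, ?_⟩⟩
  · refine add_mem (sub_mem (sum_mem fun j _ => ?_) (sum_mem fun j _ => ?_)) hpair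
    · exact bsym_mem_levelSym (isLevel66_das33 j).1.1 (isLevel66_das33 j).1.2
    · exact bsym_mem_levelSym (isLevel66_das33 j).2.1 (isLevel66_das33 j).2.2
  · simp only [wordSym, Fin.sum_univ_two, Matrix.cons_val_zero, Matrix.cons_val_one, map_add, map_sub,
      weight_bsym]
    unfold fracInd
    decide +kernel
  · refine sub_mem (sub_mem (sub_mem (sum_mem fun j _ => ?_) (sum_mem fun l _ => l.elim0))
      (AddSubgroup.nsmul_mem _ (bsym_mem_levelSym hhalf hhalf) 3)) hpair
    exact bsym_mem_levelSym (isLevel66_fermat33 j).1 (isLevel66_fermat33 j).2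
  · simp only [wordSym, x33, y33, Fin.sum_univ_five, Finset.univ_eq_empty, Finset.sum_empty, sub_zero,
      Matrix.cons_val_zero, Matrix.cons_val_one, Matrix.cons_val_two, Matrix.cons_val_three,
      Matrix.cons_val_four, Matrix.head_cons, Matrix.tail_cons, map_add, map_sub, map_nsmul, weight_bsym]
    unfold fracInd
    decide +kernel

end Summit.KontsevichZagierPeriods.GammaHodgeSectorRaise66

end
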